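import Mathlib
import Literature.MathematicalPhysics.QuantumFieldTheory.Balaban1983to89.B13ScaleTransfer

/-!
# `Balaban1983to89.B14.Eq243PointCount` — T. Bałaban, *Convergent renormalization expansions for lattice gauge theories*,
# Commun. Math. Phys. **119** (1988) 243–285 [Balaban1988Convergent]: the point count of the summation step (3.67) ⇒ (2.43)
# p. 283 / Theorem 2 p. 263 — *"The volumes are taken in the corresponding scales"*: the number of sites `z` of the `j`-th
# lattice in a region of the `n`-th lattice is at most `(Lⁿ⁻ʲ)^d` times the number of sites of that region, PROVED

statement-level skeleton of published theorems with citation tags; proofs where landed; nothing here is a claim about the Yang–Mills mass gap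

PDF held: `paper:balaban1988-cmp119-convergent-renormalization` (journal page = PDF page + 242); p. 263 [PDF 21] and p. 283
[PDF 41] re-read as images on the x2 renders of the cell `pub-balaban`.

CITATION HEADER (lean-in-tree rule).  WHAT IS REPRODUCED, verbatim.  [Balaban1988Convergent] Theorem 2 p. 263: *"… ≦ E₁
Σ_{n=j}^{k}(L^{j−n})^β|Γ_n∩Ω| (2.43) … The volumes are taken in the corresponding scales, i.e. |Γ_n∩Ω| means the number of
points in the set Γ_n∩Ω ⊂ T₁^{(n)}."*; p. 283: *"𝐄^{(j)}(Λ_j, U_k, z) − 𝐄^{(j)}(Λ_j, 1, z) − β_jA(h_z, U_k) = O((LʲL⁻ⁿ)^{5−β}),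
(3.67) for z ∈ Λ_j⁰∩(Ω_n∖Ω_{n+1}), β > 0. Summing over z ∈ Λ_j⁰∩Ω we get the inequality (2.43) in Theorem 2 (with 1 − β, β > 0,
instead of β < 1)."* — the passage from the exponent `5 − β` per point `z ∈ T^{(j)}` to the exponent `1 − β` per point of
`T^{(n)}` is the count: each site of `T₁^{(n)}` carries `(Lⁿ⁻ʲ)⁴` sites of `T^{(j)}` (d = 4).

SKELETON rows (owner r11): **B14.Eq3.67** / **B14.Thm2** — the summation `B14Sect3.Rep367` ⇒ `Ineq243` (`pointSum_le`) and
its per-point packaging `B14.Thm2Assembly.PointDataE` take THE COUNT as the hypothesis *"`(Z.filter (sc z = n)).card ≤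
(L^{(n−j)})⁴ · gammaVol n ω`"* (`B14.Eq367Assembly.ineq243_of_pointData`).  THIS FILE proves the count on the index model of
`…B13ScaleTransfer` (sites of `T^{(j)}` = `Pt d = ℤ^d`; the sites of `T^{(n)}`, `n ≥ j`, = the blocks of `N^d` sites, `N = Lⁿ⁻ʲ`,
block index `coarse N` — the cell's convention for nested lattices): `blockSites`/`card_blockSites` (a block has exactly
`N^d` sites), **`card_le_pow_mul_card`** (a finite set of `j`-sites whose blocks lie in a finite set `Γ` of `n`-sites has at
most `N^d·|Γ|` elements), and the `PointDataE`-shaped real-power form **`card_filter_le_rpow_mul`** (`#{z ∈ Z : sc z = n} ≤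
(L^{(n−j)})^d · |Γ_n|` with the real exponent `((n:ℝ) − j)` of `B14Sect3.Rep367`; d = 4 is the printed `(L^{n−j})⁴`).
Theorems + one `def` with body; no `sorry`.

Mega-formalization `lit-balaban`, unit `lit-balaban-r11` gen 6 (B14 fold owner), HOME `run/shared/lean/pub/lit-balaban/`.

## References
* [Balaban1988Convergent] T. Bałaban, Commun. Math. Phys. 119 (1988) 243–285, Thm 2 (2.43) p.263, (3.67) p.283.
-/

namespace Literature.MathematicalPhysics.QuantumFieldTheory.Balaban1983to89.B14.Eq243PointCount

open Literature.MathematicalPhysics.QuantumFieldTheory.Balaban1983to89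
open Literature.MathematicalPhysics.QuantumFieldTheory.Balaban1983to89.B13ScaleTransfer
open Finset

variable {d : ℕ}

/-- **The sites of `T^{(j)}` over one site `b` of `T^{(n)}`** (p. 263 *"the corresponding scales"*): the block
`Π_μ [Nb_μ, Nb_μ + N)` of `N^d` sites, `N = Lⁿ⁻ʲ` — the fibre of the block-index map `coarse N` over `b`.
[cite: Balaban1988Convergent, Thm 2 p.263 (volumes in the corresponding scales)] -/
noncomputable def blockSites (N : ℕ) (b : Pt d) : Finset (Pt d) :=
  Fintype.piFinset fun i => Finset.Ico ((N : ℤ) * b i) ((N : ℤ) * b i + N)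

/-- Membership in a block is "block index = `b`" (`coarse_eq_iff`). [cite: Balaban1988Convergent, Thm 2 p.263 (volumes in the corresponding scales)] -/
theorem mem_blockSites {N : ℕ} (hN : 0 < N) {b x : Pt d} : x ∈ blockSites N b ↔ coarse N x = b := by
  rw [coarse_eq_iff hN x b]
  simp only [blockSites, Fintype.mem_piFinset, Finset.mem_Ico]
  refine forall_congr' fun i => ?_
  constructor
  · rintro ⟨h1, h2⟩
    exact ⟨h1, by linarith⟩
  · rintro ⟨h1, h2⟩
    exact ⟨h1, by linarith⟩

/-- **A site of `T^{(n)}` carries exactly `N^d` sites of `T^{(j)}`** (`N = Lⁿ⁻ʲ`; d = 4: `(Lⁿ⁻ʲ)⁴`).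
[cite: Balaban1988Convergent, Thm 2 p.263 (volumes in the corresponding scales)] -/
theorem card_blockSites (N : ℕ) (b : Pt d) : (blockSites N b).card = N ^ d := by
  rw [blockSites, Fintype.card_piFinset]
  have h : ∀ i : Fin d, (Finset.Ico ((N : ℤ) * b i) ((N : ℤ) * b i + N)).card = N := by
    intro i
    rw [Int.card_Ico]
    have : (N : ℤ) * b i + N - (N : ℤ) * b i = N := by ring
    rw [this]
    rfl
  simp [h, Finset.prod_const, Finset.card_univ, Fintype.card_fin]

/-- **THE COUNT**: a finite set `Z` of sites of `T^{(j)}` all of whose `T^{(n)}`-blocks belong to the finite set `Γ` of sites of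
`T^{(n)}` has at most `N^d·|Γ|` elements — *"|Γ_n∩Ω| means the number of points in the set Γ_n∩Ω ⊂ T₁^{(n)}"*, each such point
accounting for `(Lⁿ⁻ʲ)^d` points `z` of the `j`-th lattice. [cite: Balaban1988Convergent, Thm 2 (2.43) p.263] -/
theorem card_le_pow_mul_card {N : ℕ} (hN : 0 < N) (Z Γ : Finset (Pt d)) (h : ∀ z ∈ Z, coarse N z ∈ Γ) :
    Z.card ≤ N ^ d * Γ.card := by
  classical
  calc Z.card ≤ (Γ.biUnion (blockSites N)).card :=
        card_le_card fun z hz => mem_biUnion.2 ⟨coarse N z, h z hz, (mem_blockSites hN).2 rfl⟩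
    _ ≤ ∑ b ∈ Γ, (blockSites N b).card := card_biUnion_le
    _ = ∑ _b ∈ Γ, N ^ d := sum_congr rfl fun b _ => card_blockSites N b
    _ = N ^ d * Γ.card := by rw [sum_const, smul_eq_mul, mul_comm]

/-- The same for the points `z` of a given scale `n = sc z` among a finite family `Z` (the shape of the per-point data of
(3.67): *"for z ∈ Λ_j⁰∩(Ω_n∖Ω_{n+1})"*): if every `z ∈ Z` with `sc z = n` has its `T^{(n)}`-block in `Γ_n` (= the sites of
`Γ_n∩Ω ⊂ T₁^{(n)}`), then `#{z ∈ Z : sc z = n} ≤ N^d·|Γ_n|`. [cite: Balaban1988Convergent, (3.67) p.283] -/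
theorem card_filter_le_pow_mul {N : ℕ} (hN : 0 < N) (Z Γ : Finset (Pt d)) (sc : Pt d → ℕ) (n : ℕ)
    (h : ∀ z ∈ Z, sc z = n → coarse N z ∈ Γ) :
    (Z.filter fun z => sc z = n).card ≤ N ^ d * Γ.card :=
  card_le_pow_mul_card hN _ Γ fun z hz => by
    rw [mem_filter] at hz
    exact h z hz.1 hz.2

/-- `(L^{(n−j)})^d` as the real power of `B14Sect3.Rep367`/`B14.Thm2Assembly.PointDataE`: for `j ≤ n`,
`((L:ℝ)^{((n:ℝ) − j)})^{(d:ℝ)} = ((Lⁿ⁻ʲ)^d : ℕ)`. [folklore] -/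
private theorem rpow_count_eq {L : ℕ} {j n : ℕ} (hjn : j ≤ n) :
    ((L : ℝ) ^ ((n : ℝ) - j)) ^ (d : ℝ) = (((L ^ (n - j)) ^ d : ℕ) : ℝ) := by
  have e : ((n : ℝ) - j) = ((n - j : ℕ) : ℝ) := by rw [Nat.cast_sub hjn]
  rw [e, Real.rpow_natCast, Real.rpow_natCast]
  push_cast
  ring

/-- **The count in the shape consumed by `B14.Thm2Assembly.PointDataE` / `B14.Eq367Assembly.ineq243_of_pointData`** (last
conjunct, with `gammaVol n ω := |Γ_n|`): `(#{z ∈ Z : sc z = n} : ℝ) ≤ (L^{((n:ℝ)−j)})^{(d:ℝ)} · |Γ_n|` for `1 ≤ L`, `j ≤ n`;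
d = 4 gives the printed `(L^{n−j})⁴|Γ_n∩Ω|`. [cite: Balaban1988Convergent, (3.67) p.283, (2.43) p.263] -/
theorem card_filter_le_rpow_mul {L : ℕ} (hL : 0 < L) {j n : ℕ} (hjn : j ≤ n) (Z Γ : Finset (Pt d)) (sc : Pt d → ℕ)
    (h : ∀ z ∈ Z, sc z = n → coarse (L ^ (n - j)) z ∈ Γ) :
    ((Z.filter fun z => sc z = n).card : ℝ) ≤ ((L : ℝ) ^ ((n : ℝ) - j)) ^ (d : ℝ) * Γ.card := by
  have hc := card_filter_le_pow_mul (pow_pos hL (n - j)) Z Γ sc n h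
  rw [rpow_count_eq hjn]
  exact_mod_cast hc

end Literature.MathematicalPhysics.QuantumFieldTheory.Balaban1983to89.B14.Eq243PointCount
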